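import Summits.Ventures.QEC.Census.BB.BB288.CoverCore
import Summits.Ventures.QEC.Census.BB.BB288.CoverReps
import Summits.Ventures.QEC.Census.BB.BB288.CoverL10V29
import HarnessLib

set_option Elab.async false

/-!
# `[[288,12,18]]` cover certificate — LEVEL 1→0 LINKS 29: representatives 581–582 carry no bad word of weight `≤ 16` (`rep_i_ok`, from the verdicts `p_i_okD` of CoverL10V29) and the range collector `reps1_ok_29`
(qec-search-9 g4 LINK module per qec-type-10 COVER-ASSEMBLY-TEMPLATE v1.0 §1/§2; generated by work/links/gen_links.py.)
-/

namespace Summit.Ventures.QEC.Census.BB288Cover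

open Summit.Ventures.QEC.Census

/-- Level-1→0 representative 581: no bad word of weight `≤ 16` pushes to `reps1[581]` (TEMPLATE §1, T0 `noBadOver_of_levelLabel`; the `u`-links decided in the kernel on `reps1.getD 581 0`, the lift identity reused from `p581_okD`). -/
theorem rep581_ok : NoBadOver cov1 bb288HX bb288HZ 16 (reps1.getD 581 0) := by
  have hu : reps1.getD 581 0 = 6178420484286704384757805160429931986944 := by decide +kernel
  rw [hu]
  exact noBadOver_of_levelLabel covs_ok.1 covs_ok.2.1 rows_ok.1 hDq1 (cosetOK_of_cosetOKD D1_ker p581_okD.1)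
    rfl (sigma_eq_of_Q (by decide) (by decide +kernel)) (by decide +kernel)
    (buEvenOK_of_P p581_okD.2.1) (labelCheckOK_of_P p581_okD.2.2.2 p581_okD.2.2.1) LX288_length hLab288

/-- Level-1→0 representative 582: no bad word of weight `≤ 16` pushes to `reps1[582]` (TEMPLATE §1, T0 `noBadOver_of_levelLabel`; the `u`-links decided in the kernel on `reps1.getD 582 0`, the lift identity reused from `p582_okD`). -/
theorem rep582_ok : NoBadOver cov1 bb288HX bb288HZ 16 (reps1.getD 582 0) := by
  have hu : reps1.getD 582 0 = 49766486006265338146720044422726575718400 := by decide +kernel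
  rw [hu]
  exact noBadOver_of_levelLabel covs_ok.1 covs_ok.2.1 rows_ok.1 hDq1 (cosetOK_of_cosetOKD D1_ker p582_okD.1)
    rfl (sigma_eq_of_Q (by decide) (by decide +kernel)) (by decide +kernel)
    (buEvenOK_of_P p582_okD.2.1) (labelCheckOK_of_P p582_okD.2.2.2 p582_okD.2.2.1) LX288_length hLab288

/-- Collector for representatives 581 ≤ j < 583. -/
theorem reps1_ok_29 : ∀ j : ℕ, j < 583 → 581 ≤ j → NoBadOver cov1 bb288HX bb288HZ 16 (reps1.getD j 0) := by
  intro j hj hj'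
  interval_cases j
  · exact rep581_ok
  · exact rep582_ok

end Summit.Ventures.QEC.Census.BB288Cover
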